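import Mathlib

/-!
# Crux `CubicForrelation.NearExactIsExact` (stmt-QuantumAdvantage-14043) — E1280-even, R4 branch, the d-level leaf of descendant `0`:
  EVALUATION of the cubic form at block vectors

Certificate seat `b2b-cforr-cert` (gen 43).  HONEST FRAMING: kernel-checked Finset bookkeeping (standard axioms, Mathlib only), the
first tool for the leaf statement `HLEAF` of …CubicFormR4ZReduce (`tpw_R4_zero_of_leaf`): a coefficient tensor `d` on `Fin (5 + 7)`
(`y = κ0`, `v_t = κ(t+1)`, `z_j = σ j`) which is symmetric with zero diagonals, with `d(y,·,·)` supported on `v × v`, `d(y,v,z) =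
d(y,z,z) = 0` and `d(z,z,z) = 0`, evaluated trilinearly at three block vectors `(u_y; u_V; u_Z)` (`Fin.append (Fin.cons u_y u_V) u_Z`),
is the sum of its ten surviving blocks (`tq5_eval_raw`); with the leaf's slices `d(y,v_t,v_t') = ω_tt'`, `d(v_t,z_j,z_k) = a_t Ξ_jk`,
`d(v_t,v_t',z_j) = ω_tt' E_j + a_t M_t'j + a_t' M_tj` substituted this is `tq5_eval`.  This is how the slices of the TRANSPORTED tensor
`d'_{φjk} = Σ P_ψφ P_aj P_bk d_ψab` (columns of `P` = block vectors) will be computed.  Nothing about `θ₁₂`; NOT summit progress.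

References: folklore multilinear algebra.  Axioms: the standard three.
-/

set_option linter.dupNamespace false -- D-0017: single-problem summit ⇒ `QuantumAdvantage.QuantumAdvantage` by design

namespace Summit.QuantumAdvantage.QuantumAdvantage.Theorems.CubicForrelation.NearExactIsExact

open Finset

/-- Splitting a sum over `Fin (5 + 7)` into the `y`, `v` and `z` blocks. [folklore] -/
theorem tq5_split {R : Type*} [AddCommMonoid R] (f : Fin (5 + 7) → R) :
    (∑ ψ, f ψ) = f (Fin.castAdd 7 0) + (∑ t : Fin 4, f (Fin.castAdd 7 t.succ)) + ∑ k : Fin 7, f (Fin.natAdd 5 k) := by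
  rw [Fin.sum_univ_add, Fin.sum_univ_succ]

/-- **Trilinear evaluation at block vectors, raw form.**  See the module docstring. [folklore] -/
theorem tq5_eval_raw (d : Fin (5 + 7) → Fin (5 + 7) → Fin (5 + 7) → ZMod 2) (hds : ∀ φ j k, d φ k j = d φ j k) (hdc : ∀ φ j k, d j φ k = d φ j k) (hdd : ∀ φ j, d φ j j = 0)
    (hyy : ∀ x, d (Fin.castAdd 7 (0 : Fin 5)) (Fin.castAdd 7 (0 : Fin 5)) x = 0) (hyvz : ∀ (t : Fin 4) (j : Fin 7), d (Fin.castAdd 7 (0 : Fin 5)) (Fin.castAdd 7 (Fin.succ t)) (Fin.natAdd 5 j) = 0)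
    (hyzz : ∀ j k : Fin 7, d (Fin.castAdd 7 (0 : Fin 5)) (Fin.natAdd 5 j) (Fin.natAdd 5 k) = 0) (hzzz : ∀ σ τ υ : Fin 7, d (Fin.natAdd 5 σ) (Fin.natAdd 5 τ) (Fin.natAdd 5 υ) = 0)
    (uy vy wy : ZMod 2) (uV vV wV : Fin 4 → ZMod 2) (uZ vZ wZ : Fin 7 → ZMod 2) :
    (∑ ψ, ∑ α, ∑ β, (Fin.append (Fin.cons (uy) (uV) : Fin 5 → ZMod 2) (uZ) : Fin (5 + 7) → ZMod 2) ψ * (Fin.append (Fin.cons (vy) (vV) : Fin 5 → ZMod 2) (vZ) : Fin (5 + 7) → ZMod 2) α * (Fin.append (Fin.cons (wy) (wV) : Fin 5 → ZMod 2) (wZ) : Fin (5 + 7) → ZMod 2) β * d ψ α β) =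
      (∑ t : Fin 4, ∑ t' : Fin 4, uy * vV t * wV t' * d (Fin.castAdd 7 (0 : Fin 5)) (Fin.castAdd 7 (Fin.succ t)) (Fin.castAdd 7 (Fin.succ t'))) +
      (∑ t : Fin 4, ∑ t' : Fin 4, uV t * vy * wV t' * d (Fin.castAdd 7 (0 : Fin 5)) (Fin.castAdd 7 (Fin.succ t)) (Fin.castAdd 7 (Fin.succ t'))) +
      (∑ t : Fin 4, ∑ t' : Fin 4, uV t * vV t' * wy * d (Fin.castAdd 7 (0 : Fin 5)) (Fin.castAdd 7 (Fin.succ t)) (Fin.castAdd 7 (Fin.succ t'))) +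
      (∑ t : Fin 4, ∑ t' : Fin 4, ∑ t'' : Fin 4, uV t * vV t' * wV t'' * d (Fin.castAdd 7 (Fin.succ t)) (Fin.castAdd 7 (Fin.succ t')) (Fin.castAdd 7 (Fin.succ t''))) +
      (∑ t : Fin 4, ∑ t' : Fin 4, ∑ j : Fin 7, uV t * vV t' * wZ j * d (Fin.castAdd 7 (Fin.succ t)) (Fin.castAdd 7 (Fin.succ t')) (Fin.natAdd 5 j)) +
      (∑ t : Fin 4, ∑ j : Fin 7, ∑ t' : Fin 4, uV t * vZ j * wV t' * d (Fin.castAdd 7 (Fin.succ t)) (Fin.castAdd 7 (Fin.succ t')) (Fin.natAdd 5 j)) +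
      (∑ j : Fin 7, ∑ t : Fin 4, ∑ t' : Fin 4, uZ j * vV t * wV t' * d (Fin.castAdd 7 (Fin.succ t)) (Fin.castAdd 7 (Fin.succ t')) (Fin.natAdd 5 j)) +
      (∑ t : Fin 4, ∑ j : Fin 7, ∑ k : Fin 7, uV t * vZ j * wZ k * d (Fin.castAdd 7 (Fin.succ t)) (Fin.natAdd 5 j) (Fin.natAdd 5 k)) +
      (∑ j : Fin 7, ∑ t : Fin 4, ∑ k : Fin 7, uZ j * vV t * wZ k * d (Fin.castAdd 7 (Fin.succ t)) (Fin.natAdd 5 j) (Fin.natAdd 5 k)) +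
      (∑ j : Fin 7, ∑ k : Fin 7, ∑ t : Fin 4, uZ j * vZ k * wV t * d (Fin.castAdd 7 (Fin.succ t)) (Fin.natAdd 5 j) (Fin.natAdd 5 k)) := by
  have z1 : ∀ x, d (Fin.castAdd 7 (0 : Fin 5)) x (Fin.castAdd 7 (0 : Fin 5)) = 0 := fun x => by rw [hds]; exact hyy x
  have z2 : ∀ x, d x (Fin.castAdd 7 (0 : Fin 5)) (Fin.castAdd 7 (0 : Fin 5)) = 0 := fun x => hdd x _
  have z3 : ∀ (t : Fin 4) (j : Fin 7), d (Fin.castAdd 7 (0 : Fin 5)) (Fin.natAdd 5 j) (Fin.castAdd 7 (Fin.succ t)) = 0 := fun t j => by rw [hds]; exact hyvz t j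
  have z4 : ∀ (t : Fin 4) (j : Fin 7), d (Fin.castAdd 7 (Fin.succ t)) (Fin.castAdd 7 (0 : Fin 5)) (Fin.natAdd 5 j) = 0 := fun t j => by rw [hdc]; exact hyvz t j
  have z5 : ∀ (t : Fin 4) (j : Fin 7), d (Fin.castAdd 7 (Fin.succ t)) (Fin.natAdd 5 j) (Fin.castAdd 7 (0 : Fin 5)) = 0 := fun t j => by rw [hds, hdc]; exact hyvz t j
  have z6 : ∀ (t : Fin 4) (j : Fin 7), d (Fin.natAdd 5 j) (Fin.castAdd 7 (0 : Fin 5)) (Fin.castAdd 7 (Fin.succ t)) = 0 := fun t j => by rw [hdc, hds]; exact hyvz t j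
  have z7 : ∀ (t : Fin 4) (j : Fin 7), d (Fin.natAdd 5 j) (Fin.castAdd 7 (Fin.succ t)) (Fin.castAdd 7 (0 : Fin 5)) = 0 := fun t j => by rw [hds, hdc, hds]; exact hyvz t j
  have z8 : ∀ j k : Fin 7, d (Fin.natAdd 5 j) (Fin.castAdd 7 (0 : Fin 5)) (Fin.natAdd 5 k) = 0 := fun j k => by rw [hdc]; exact hyzz j k
  have z9 : ∀ j k : Fin 7, d (Fin.natAdd 5 j) (Fin.natAdd 5 k) (Fin.castAdd 7 (0 : Fin 5)) = 0 := fun j k => by rw [hds, hdc]; exact hyzz j k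
  have n1 : ∀ t t' : Fin 4, d (Fin.castAdd 7 (Fin.succ t)) (Fin.castAdd 7 (0 : Fin 5)) (Fin.castAdd 7 (Fin.succ t')) = d (Fin.castAdd 7 (0 : Fin 5)) (Fin.castAdd 7 (Fin.succ t)) (Fin.castAdd 7 (Fin.succ t')) := fun t t' => hdc _ _ _
  have n2 : ∀ t t' : Fin 4, d (Fin.castAdd 7 (Fin.succ t)) (Fin.castAdd 7 (Fin.succ t')) (Fin.castAdd 7 (0 : Fin 5)) = d (Fin.castAdd 7 (0 : Fin 5)) (Fin.castAdd 7 (Fin.succ t)) (Fin.castAdd 7 (Fin.succ t')) := fun t t' => by rw [hds, hdc]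
  have n3 : ∀ (t t' : Fin 4) (j : Fin 7), d (Fin.castAdd 7 (Fin.succ t)) (Fin.natAdd 5 j) (Fin.castAdd 7 (Fin.succ t')) = d (Fin.castAdd 7 (Fin.succ t)) (Fin.castAdd 7 (Fin.succ t')) (Fin.natAdd 5 j) := fun t t' j => hds _ _ _
  have n4 : ∀ (t t' : Fin 4) (j : Fin 7), d (Fin.natAdd 5 j) (Fin.castAdd 7 (Fin.succ t)) (Fin.castAdd 7 (Fin.succ t')) = d (Fin.castAdd 7 (Fin.succ t)) (Fin.castAdd 7 (Fin.succ t')) (Fin.natAdd 5 j) := fun t t' j => by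
    rw [hdc, hds]
  have n5 : ∀ (t : Fin 4) (j k : Fin 7), d (Fin.natAdd 5 j) (Fin.castAdd 7 (Fin.succ t)) (Fin.natAdd 5 k) = d (Fin.castAdd 7 (Fin.succ t)) (Fin.natAdd 5 j) (Fin.natAdd 5 k) := fun t j k => hdc _ _ _
  have n6 : ∀ (t : Fin 4) (j k : Fin 7), d (Fin.natAdd 5 j) (Fin.natAdd 5 k) (Fin.castAdd 7 (Fin.succ t)) = d (Fin.castAdd 7 (Fin.succ t)) (Fin.natAdd 5 j) (Fin.natAdd 5 k) := fun t j k => by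
    rw [hds, hdc]
  simp only [tq5_split, Fin.append_left, Fin.append_right, Fin.cons_zero, Fin.cons_succ, hyy, z1, z2, hyvz, z3, z4, z5, z6, z7,
    hyzz, z8, z9, hzzz, n1, n2, n3, n4, n5, n6, mul_zero, sum_const_zero, add_zero, zero_add, sum_add_distrib]
  ring

/-- **Trilinear evaluation at block vectors** for the leaf's data: the slices `d(y,v_t,v_t') = ω_tt'`, `d(v_t,z_j,z_k) = a_t Ξ_jk`
and `d(v_t,v_t',z_j) = ω_tt'E_j + a_tM_t'j + a_t'M_tj` substituted into `tq5_eval_raw`. [this work] -/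
theorem tq5_eval (d : Fin (5 + 7) → Fin (5 + 7) → Fin (5 + 7) → ZMod 2) (hds : ∀ φ j k, d φ k j = d φ j k) (hdc : ∀ φ j k, d j φ k = d φ j k) (hdd : ∀ φ j, d φ j j = 0)
    (hF : ∀ j k, d (Fin.castAdd 7 (0 : Fin 5)) j k =
      (if (j = Fin.castAdd 7 (1 : Fin 5) ∧ k = Fin.castAdd 7 (2 : Fin 5)) ∨ (j = Fin.castAdd 7 (2 : Fin 5) ∧ k = Fin.castAdd 7 (1 : Fin 5)) then 1 else 0) +
      (if (j = Fin.castAdd 7 (3 : Fin 5) ∧ k = Fin.castAdd 7 (4 : Fin 5)) ∨ (j = Fin.castAdd 7 (4 : Fin 5) ∧ k = Fin.castAdd 7 (3 : Fin 5)) then 1 else 0))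
    (hzzz : ∀ σ τ υ : Fin 7, d (Fin.natAdd 5 σ) (Fin.natAdd 5 τ) (Fin.natAdd 5 υ) = 0) (a : Fin 4 → ZMod 2) (Ξ : Fin 7 → Fin 7 → ZMod 2)
    (hdΞ : ∀ (t : Fin 4) (j k : Fin 7), d (Fin.castAdd 7 t.succ) (Fin.natAdd 5 j) (Fin.natAdd 5 k) = a t * Ξ j k)
    (E : Fin 7 → ZMod 2) (M : Fin 4 → Fin 7 → ZMod 2)
    (hdL : ∀ (t t' : Fin 4) (j : Fin 7), d (Fin.castAdd 7 t.succ) (Fin.castAdd 7 t'.succ) (Fin.natAdd 5 j) =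
      ((if (t = 0 ∧ t' = 1) ∨ (t = 1 ∧ t' = 0) then (1 : ZMod 2) else 0) + (if (t = 2 ∧ t' = 3) ∨ (t = 3 ∧ t' = 2) then (1 : ZMod 2) else 0)) * E j + a t * M t' j + a t' * M t j)
    (uy vy wy : ZMod 2) (uV vV wV : Fin 4 → ZMod 2) (uZ vZ wZ : Fin 7 → ZMod 2) :
    (∑ ψ, ∑ α, ∑ β, (Fin.append (Fin.cons (uy) (uV) : Fin 5 → ZMod 2) (uZ) : Fin (5 + 7) → ZMod 2) ψ * (Fin.append (Fin.cons (vy) (vV) : Fin 5 → ZMod 2) (vZ) : Fin (5 + 7) → ZMod 2) α * (Fin.append (Fin.cons (wy) (wV) : Fin 5 → ZMod 2) (wZ) : Fin (5 + 7) → ZMod 2) β * d ψ α β) =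
      (∑ t : Fin 4, ∑ t' : Fin 4, uy * vV t * wV t' * ((if (t = 0 ∧ t' = 1) ∨ (t = 1 ∧ t' = 0) then (1 : ZMod 2) else 0) + (if (t = 2 ∧ t' = 3) ∨ (t = 3 ∧ t' = 2) then (1 : ZMod 2) else 0))) +
      (∑ t : Fin 4, ∑ t' : Fin 4, uV t * vy * wV t' * ((if (t = 0 ∧ t' = 1) ∨ (t = 1 ∧ t' = 0) then (1 : ZMod 2) else 0) + (if (t = 2 ∧ t' = 3) ∨ (t = 3 ∧ t' = 2) then (1 : ZMod 2) else 0))) +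
      (∑ t : Fin 4, ∑ t' : Fin 4, uV t * vV t' * wy * ((if (t = 0 ∧ t' = 1) ∨ (t = 1 ∧ t' = 0) then (1 : ZMod 2) else 0) + (if (t = 2 ∧ t' = 3) ∨ (t = 3 ∧ t' = 2) then (1 : ZMod 2) else 0))) +
      (∑ t : Fin 4, ∑ t' : Fin 4, ∑ t'' : Fin 4, uV t * vV t' * wV t'' * d (Fin.castAdd 7 (Fin.succ t)) (Fin.castAdd 7 (Fin.succ t')) (Fin.castAdd 7 (Fin.succ t''))) +
      (∑ t : Fin 4, ∑ t' : Fin 4, ∑ j : Fin 7, uV t * vV t' * wZ j * (((if (t = 0 ∧ t' = 1) ∨ (t = 1 ∧ t' = 0) then (1 : ZMod 2) else 0) + (if (t = 2 ∧ t' = 3) ∨ (t = 3 ∧ t' = 2) then (1 : ZMod 2) else 0)) * E j + a t * M t' j + a t' * M t j)) +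
      (∑ t : Fin 4, ∑ j : Fin 7, ∑ t' : Fin 4, uV t * vZ j * wV t' * (((if (t = 0 ∧ t' = 1) ∨ (t = 1 ∧ t' = 0) then (1 : ZMod 2) else 0) + (if (t = 2 ∧ t' = 3) ∨ (t = 3 ∧ t' = 2) then (1 : ZMod 2) else 0)) * E j + a t * M t' j + a t' * M t j)) +
      (∑ j : Fin 7, ∑ t : Fin 4, ∑ t' : Fin 4, uZ j * vV t * wV t' * (((if (t = 0 ∧ t' = 1) ∨ (t = 1 ∧ t' = 0) then (1 : ZMod 2) else 0) + (if (t = 2 ∧ t' = 3) ∨ (t = 3 ∧ t' = 2) then (1 : ZMod 2) else 0)) * E j + a t * M t' j + a t' * M t j)) +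
      (∑ t : Fin 4, ∑ j : Fin 7, ∑ k : Fin 7, uV t * vZ j * wZ k * (a t * Ξ j k)) +
      (∑ j : Fin 7, ∑ t : Fin 4, ∑ k : Fin 7, uZ j * vV t * wZ k * (a t * Ξ j k)) +
      (∑ j : Fin 7, ∑ k : Fin 7, ∑ t : Fin 4, uZ j * vZ k * wV t * (a t * Ξ j k)) := by
  have hz : ∀ j : Fin 7, (Fin.natAdd 5 j : Fin (5 + 7)) ≠ 1 ∧ (Fin.natAdd 5 j : Fin (5 + 7)) ≠ 2 ∧ (Fin.natAdd 5 j : Fin (5 + 7)) ≠ 3 ∧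
      (Fin.natAdd 5 j : Fin (5 + 7)) ≠ 4 := by decide
  have hyy : ∀ x, d (Fin.castAdd 7 (0 : Fin 5)) (Fin.castAdd 7 (0 : Fin 5)) x = 0 := fun x => by rw [hF]; simp
  have hyvz : ∀ (t : Fin 4) (j : Fin 7), d (Fin.castAdd 7 (0 : Fin 5)) (Fin.castAdd 7 (Fin.succ t)) (Fin.natAdd 5 j) = 0 := fun t j => by rw [hF]; simp [hz]
  have hyzz : ∀ j k : Fin 7, d (Fin.castAdd 7 (0 : Fin 5)) (Fin.natAdd 5 j) (Fin.natAdd 5 k) = 0 := fun j k => by rw [hF]; simp [hz]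
  have hFvv : ∀ t t' : Fin 4, d (Fin.castAdd 7 (0 : Fin 5)) (Fin.castAdd 7 (Fin.succ t)) (Fin.castAdd 7 (Fin.succ t')) = ((if (t = 0 ∧ t' = 1) ∨ (t = 1 ∧ t' = 0) then (1 : ZMod 2) else 0) + (if (t = 2 ∧ t' = 3) ∨ (t = 3 ∧ t' = 2) then (1 : ZMod 2) else 0)) := by
    intro t t'
    have e := hF (Fin.castAdd 7 (Fin.succ t)) (Fin.castAdd 7 (Fin.succ t'))
    fin_cases t <;> fin_cases t' <;> simpa [Fin.castAdd_inj] using e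
  rw [tq5_eval_raw d hds hdc hdd hyy hyvz hyzz hzzz]
  simp only [hFvv, hdΞ, hdL]

end Summit.QuantumAdvantage.QuantumAdvantage.Theorems.CubicForrelation.NearExactIsExact
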